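import Summits.QuantumFields.YangMills.Theorems.ColdStartUniversalityLatticeLangevinDynkinSZZ
import Summits.QuantumFields.YangMills.Theorems.ColdStartUniversalityLatticeLangevinItoProcessMoments
import HarnessLib

/-!
# Route `ColdStartUniversality`, crux K_A2 `ColdStartContinuumCauchy` (stmt-QuantumFields-24810), LINE 3 «lindeberg_swap»:
# STOCHASTIC CONTINUITY OF THE SU(2) LATTICE LANGEVIN (SZZ) DYNAMICS, I: coordinate increments along the regular flow

Helper file, part I of II (seat `ym-line-csu-p1`, g9; `--supports stmt-QuantumFields-24810`); part II
(`…LatticeLangevinStochasticContinuity`) carries the Hilbert–Schmidt and arbitrary-realisation forms.  Input (c) of the rung analysis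
`rung-shortWindowSwap-wall.md` (evidence #18 on the crux): for the Shen–Zhu–Zhu system on `SU(2)^E`, `E = Edge 3 L`, at any
coupling `β`, there is `C = C(L, β)` such that

* along the regular solution flow `U` (every probability space, progressive clause of `exists_regularFlow`), every real link
  coordinate has increments with `E[(X_v − X_u)²] ≤ C((v−u)² + (v−u))` (`integral_coordIncr_sq_le_flow`) and the squared
  Hilbert–Schmidt «distance» satisfies `E[Σ_e ‖ρ(U^x_v e) − ρ(U^x_u e)‖_F²] ≤ C((v−u)² + (v−u))` (`integral_hsDist_le_flow`),
  for ALL starts `x` and lattice times `u ≤ v`;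
* for EVERY solution `U` from a deterministic start `x` on ANY probability space with any flat Brownian driver,
  `E[Σ_e ‖ρ(U_h e) − ρ(x e)‖_F²] ≤ C(h² + h)` (`integral_hsDist_start_le`) and, by Markov's inequality,
  `P(Σ_e ‖ρ(U_h e) − ρ(x e)‖_F² ≥ r) ≤ C(h² + h)/r` (`measureReal_hsDist_start_ge_le`) — uniform-in-start stochastic continuity
  of THE transition kernels of the dynamics.

Proof: the increment-moment lemma for Itô processes with bounded coefficients (`incr_moments`, joint raw filtration of the
flattened driver) instantiated on the real coordinates of the regular flow exactly as in `dynkin_expectation_szz`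
(coefficient bounds `exists_bound_coeff`, progressivity along the flow `isStronglyProgressive_comp_flow`, the coordinate
integral equations = Re/Im of `IsSolution.exists_ito`, zero Itô integrals for the other links), the identity
`‖ρ(a) − ρ(b)‖_F² = Σ_{ij} (Re² + Im²)` (`hsForm_self`), and transfer to arbitrary realisations by uniqueness in law from a
deterministic start (`lawUnique_of_start`) through the regular flow on the product Wiener space (`exists_regularFlow`,
`isFlatBrownian_piWiener`).  THEOREMS ONLY, no definition, no sorry.  RECORD-rung R3 plumbing for LINE 3 (its rung as typed
needs more, see the memo); no crux, rung or summit is proved; the Yang–Mills mass gap is NOT proved.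
-/

set_option autoImplicit false

noncomputable section

namespace Summit.QuantumFields.YangMills.Theorems.ColdStartUniversality

open MeasureTheory ProbabilityTheory Finset
open scoped NNReal ENNReal
open Literature.Probability.Process Literature.MathematicalPhysics.QuantumFieldTheory
open Literature.MathematicalPhysics.QuantumLattice (fundamentalRep fundamentalLatticeRep continuous_fundamentalRep)

/-- **Second moments of the coordinate increments along the regular SZZ flow.**  There is `C = C(L, β) ≥ 0` such that
for every probability space with a flat Brownian driver, every solution family `U` from all starts with the progressive
clause of `exists_regularFlow`, every start `x`, link `e`, entry `(i, j)`, real/imaginary part `c` and lattice times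
`u ≤ v`, the real coordinate `X_r = (Re|Im) ρ(U^x_r e)_{ij}` has `X_v − X_u ∈ L⁴` and `E[(X_v − X_u)²] ≤ C((v−u)² + (v−u))`.
[cite: RevuzYor1999, Ch. IV Thm (2.2) (isometry); Ch. IX Def. (1.2)] -/
theorem integral_coordIncr_sq_le_flow (L : ℕ) [NeZero L] (β : ℝ) :
    ∃ C : ℝ, 0 ≤ C ∧ ∀ {Ω : Type} [MeasurableSpace Ω] {P : Measure Ω} [IsProbabilityMeasure P]
      {W : ℝ≥0 → Ω → (Edge 3 L × NoiseIdx 2 → ℝ)} (hW : IsFlatBrownian W P)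
      (U : GaugeConfig 3 L (Matrix.specialUnitaryGroup (Fin 2) ℂ) → ℝ≥0 → Ω →
        GaugeConfig 3 L (Matrix.specialUnitaryGroup (Fin 2) ℂ))
      (_hU : ∀ x, (∀ ω, U x 0 ω = x) ∧
        (latticeLangevinDynamics (fundamentalLatticeRep 2) β).IsSolution (fundamentalRep (Fin 2))
          hW.natFiltration P W (U x))
      (_hUm : ∀ i : ℝ≥0, Measurable[@Prod.instMeasurableSpace (Set.Iic i)
          (GaugeConfig 3 L (Matrix.specialUnitaryGroup (Fin 2) ℂ) × Ω) inferInstance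
          (@Prod.instMeasurableSpace (GaugeConfig 3 L (Matrix.specialUnitaryGroup (Fin 2) ℂ)) Ω inferInstance
            (hW.natFiltration i))]
        (fun q : Set.Iic i × (GaugeConfig 3 L (Matrix.specialUnitaryGroup (Fin 2) ℂ) × Ω) => U q.2.1 q.1 q.2.2))
      (x : GaugeConfig 3 L (Matrix.specialUnitaryGroup (Fin 2) ℂ)) (e : Edge 3 L) (i j : Fin 2) (c : Bool)
      (u v : ℝ≥0), u ≤ v →
      MemLp (fun ω => (fun z : ℂ => if c then z.im else z.re)
          ((fundamentalRep (Fin 2) (U x v ω e) : Matrix (Fin 2) (Fin 2) ℂ) i j) -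
        (fun z : ℂ => if c then z.im else z.re)
          ((fundamentalRep (Fin 2) (U x u ω e) : Matrix (Fin 2) (Fin 2) ℂ) i j)) 4 P ∧
      ∫ ω, ((fun z : ℂ => if c then z.im else z.re)
          ((fundamentalRep (Fin 2) (U x v ω e) : Matrix (Fin 2) (Fin 2) ℂ) i j) -
        (fun z : ℂ => if c then z.im else z.re)
          ((fundamentalRep (Fin 2) (U x u ω e) : Matrix (Fin 2) (Fin 2) ℂ) i j)) ^ 2 ∂P ≤
        C * ((((v : ℝ) - u) ^ 2) + ((v : ℝ) - u)) := by
  classical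
  obtain ⟨M, hM⟩ := exists_bound_coeff (L := L) β
  have hM0 : 0 ≤ M := (norm_nonneg _).trans (hM (fun _ => 1) default 0 0).1
  set d : ℕ := Fintype.card (Edge 3 L × NoiseIdx 2) with hd
  refine ⟨max (2 * M ^ 2) (2 * (d : ℝ) ^ 2 * M ^ 2), le_max_of_le_left (by positivity), ?_⟩
  intro Ω mΩ P hP W hW U hU hUm x e i j c u v huv
  haveI := secondCountableTopology_su2
  haveI := borelSpace_config L
  obtain ⟨hU0, hUsol⟩ := hU x
  set eqv := Fintype.equivFin (Edge 3 L × NoiseIdx 2) with heqv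
  have hfil := natFiltration_flat_eq hW
  -- real/imaginary parts are bounded by the norm
  have hreIm : ∀ (c : Bool) (z : ℂ), |(fun z : ℂ => if c then z.im else z.re) z| ≤ ‖z‖ := by
    intro c z; cases c
    · simpa using Complex.abs_re_le_norm z
    · simpa using Complex.abs_im_le_norm z
  -- measurability of the coefficient observables (verbatim from `dynkin_expectation_szz`)
  have hdriftm : ∀ (e : Edge 3 L) (i j : Fin 2) (c : Bool), Measurable fun V : GaugeConfig 3 L
      (Matrix.specialUnitaryGroup (Fin 2) ℂ) =>
      (fun z : ℂ => if c then z.im else z.re) ((latticeLangevinDynamics (fundamentalLatticeRep 2) β).drift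
        (matrixConfig (fundamentalRep (Fin 2)) V) e i j) := by
    intro e i j c
    have hc : Continuous fun V : GaugeConfig 3 L (Matrix.specialUnitaryGroup (Fin 2) ℂ) =>
        (latticeLangevinDynamics (fundamentalLatticeRep 2) β).drift (matrixConfig (fundamentalRep (Fin 2)) V) e i j :=
      (continuous_apply j).comp ((continuous_apply i).comp (continuous_drift_matrixConfig β e))
    cases c
    · exact (Complex.continuous_re.comp hc).measurable
    · exact (Complex.continuous_im.comp hc).measurable
  have hnoisem : ∀ (e : Edge 3 L) (n : NoiseIdx 2) (i j : Fin 2) (c : Bool), Measurable fun V : GaugeConfig 3 L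
      (Matrix.specialUnitaryGroup (Fin 2) ℂ) =>
      (fun z : ℂ => if c then z.im else z.re) ((latticeLangevinDynamics (fundamentalLatticeRep 2) β).noise
        (matrixConfig (fundamentalRep (Fin 2)) V) e n i j) := by
    intro e n i j c
    have hc : Continuous fun V : GaugeConfig 3 L (Matrix.specialUnitaryGroup (Fin 2) ℂ) =>
        (latticeLangevinDynamics (fundamentalLatticeRep 2) β).noise (matrixConfig (fundamentalRep (Fin 2)) V) e n i j :=
      (continuous_apply j).comp ((continuous_apply i).comp (continuous_noise_matrixConfig β e n))
    cases c
    · exact (Complex.continuous_re.comp hc).measurable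
    · exact (Complex.continuous_im.comp hc).measurable
  -- the Itô integrals of the solution, and zero integrals for the other links
  obtain ⟨Jc, hJc, hXeqC⟩ := hUsol.exists_ito
  have hzero : ∀ k : Edge 3 L × NoiseIdx 2, ∃ J0 : ℝ≥0 → Ω → ℝ,
      IsItoIntegral (fun _ _ => (0 : ℝ)) (fun r ω => W r ω k) J0 hW.natFiltration P ∧
        ∀ᵐ ω ∂P, ∀ t, J0 t ω = 0 := by
    intro k
    obtain ⟨J0, hJ0, -, -⟩ := exists_isItoIntegral_flatCoord hW k (H := fun _ _ => (0 : ℝ))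
      (isStronglyProgressive_const _ _) (fun t => by simp [sqErr])
    exact ⟨J0, hJ0, IsItoIntegral.ae_forall_eq_zero_of_integrand hJ0⟩
  choose J0 hJ0 hJ0z using hzero
  -- noise coefficients and integrals indexed by the flat pairs `(e', n)`
  set σp : (Edge 3 L × NoiseIdx 2) → ℝ≥0 → Ω → ℝ := fun p r ω =>
    if p.1 = e then (fun z : ℂ => if c then z.im else z.re)
      ((latticeLangevinDynamics (fundamentalLatticeRep 2) β).noise
        (matrixConfig (fundamentalRep (Fin 2)) (U x r ω)) e p.2 i j) else 0 with hσp
  set Jp : (Edge 3 L × NoiseIdx 2) → ℝ≥0 → Ω → ℝ := fun p =>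
    if p.1 = e then (fun t ω => (fun z : ℂ => if c then z.im else z.re) (Jc e p.2 i j t ω)) else J0 p with hJp
  have hσp_prog : ∀ p, IsStronglyProgressive hW.natFiltration (σp p) := by
    rintro ⟨e', n⟩
    by_cases h : e' = e
    · have hh := isStronglyProgressive_comp_flow hUm x (hnoisem e n i j c)
      have e1 : σp (e', n) = fun r ω => (fun z : ℂ => if c then z.im else z.re)
          ((latticeLangevinDynamics (fundamentalLatticeRep 2) β).noise
            (matrixConfig (fundamentalRep (Fin 2)) (U x r ω)) e n i j) := by
        funext r ω; simp only [hσp, h, if_true]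
      rw [e1]; exact hh
    · have hh := isStronglyProgressive_const hW.natFiltration (0 : ℝ)
      have e1 : σp (e', n) = fun _ _ => (0 : ℝ) := by funext r ω; simp only [hσp, h, if_false]
      rw [e1]; exact hh
  have hσp_bd : ∀ p r ω, |σp p r ω| ≤ M := by
    rintro ⟨e', n⟩ r ω
    by_cases h : e' = e
    · simp only [hσp, h, if_true]
      exact (hreIm _ _).trans ((hM (U x r ω) e i j).2 n)
    · simp only [hσp, h, if_false, abs_zero]; exact hM0
  have hJp_ito : ∀ p, IsItoIntegral (σp p) (fun r ω => W r ω p) (Jp p) hW.natFiltration P := by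
    rintro ⟨e', n⟩
    by_cases h : e' = e
    · subst h
      have hh := hJc e' n i j
      have e1 : σp (e', n) = fun t ω => (fun z : ℂ => if c then z.im else z.re)
          ((latticeLangevinDynamics (fundamentalLatticeRep 2) β).noise
            (matrixConfig (fundamentalRep (Fin 2)) (U x t ω)) e' n i j) := by
        funext t ω; simp only [hσp, if_true]
      have e2 : Jp (e', n) = fun t ω => (fun z : ℂ => if c then z.im else z.re) (Jc e' n i j t ω) := by
        simp only [hJp, if_true]
      rw [e1, e2]
      cases c
      · simp only [Bool.false_eq_true, if_false]
        convert hh.1 using 0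
        exact Iff.rfl
      · simp only [if_true]
        convert hh.2 using 0
        exact Iff.rfl
    · have e1 : σp (e', n) = fun _ _ => (0 : ℝ) := by funext r ω; simp only [hσp, h, if_false]
      have e2 : Jp (e', n) = J0 (e', n) := by simp only [hJp, h, if_false]
      rw [e1, e2]; exact hJ0 (e', n)
  -- the hypotheses of `incr_moments` for the flattened driver
  have hβ : IsStronglyProgressive
      (IsBrownianVec.natFiltration (W := fun t ω k => W t ω (eqv.symm k)) hW)
      (fun r ω => (fun z : ℂ => if c then z.im else z.re)
        ((latticeLangevinDynamics (fundamentalLatticeRep 2) β).drift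
          (matrixConfig (fundamentalRep (Fin 2)) (U x r ω)) e i j)) := by
    rw [← hfil]; exact isStronglyProgressive_comp_flow hUm x (hdriftm e i j c)
  have hσ : ∀ k : Fin d, IsStronglyProgressive
      (IsBrownianVec.natFiltration (W := fun t ω k => W t ω (eqv.symm k)) hW) (σp (eqv.symm k)) := by
    intro k; rw [← hfil]; exact hσp_prog _
  have hβM : ∀ r ω, |(fun z : ℂ => if c then z.im else z.re)
      ((latticeLangevinDynamics (fundamentalLatticeRep 2) β).drift
        (matrixConfig (fundamentalRep (Fin 2)) (U x r ω)) e i j)| ≤ M :=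
    fun r ω => (hreIm _ _).trans (hM (U x r ω) e i j).1
  have hσM : ∀ (k : Fin d) r ω, |σp (eqv.symm k) r ω| ≤ M := fun k r ω => hσp_bd _ r ω
  have hJ : ∀ k : Fin d, IsItoIntegral (σp (eqv.symm k)) (fun r ω => (fun t ω k => W t ω (eqv.symm k)) r ω k)
      (Jp (eqv.symm k)) (IsBrownianVec.natFiltration (W := fun t ω k => W t ω (eqv.symm k)) hW) P := by
    intro k; rw [← hfil]; exact hJp_ito _
  -- the coordinate integral equation (Re/Im of the complex one), with the flat sum reindexed over `Fin d`
  have hx : ∀ᵐ ω ∂P, ∀ t : ℝ≥0,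
      (fun z : ℂ => if c then z.im else z.re) ((fundamentalRep (Fin 2) (U x t ω e) : Matrix (Fin 2) (Fin 2) ℂ) i j) =
        (fun z : ℂ => if c then z.im else z.re) ((fundamentalRep (Fin 2) (U x 0 ω e) : Matrix (Fin 2) (Fin 2) ℂ) i j) +
        (∫ r in (0 : ℝ)..t, (fun z : ℂ => if c then z.im else z.re)
          ((latticeLangevinDynamics (fundamentalLatticeRep 2) β).drift
            (matrixConfig (fundamentalRep (Fin 2)) (U x r.toNNReal ω)) e i j)) +
        ∑ k : Fin d, Jp (eqv.symm k) t ω := by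
    have hJ0all : ∀ᵐ ω ∂P, ∀ k, ∀ t, J0 k t ω = 0 := ae_all_iff.mpr fun k => hJ0z k
    filter_upwards [hXeqC, hJ0all, hUsol.continuous] with ω hω hω0 hωc
    intro t
    have hC : ((fundamentalRep (Fin 2) (U x t ω e) : Matrix (Fin 2) (Fin 2) ℂ) i j) =
        ((fundamentalRep (Fin 2) (U x 0 ω e) : Matrix (Fin 2) (Fin 2) ℂ) i j) +
        (∫ s in (0 : ℝ)..t, (latticeLangevinDynamics (fundamentalLatticeRep 2) β).drift
          (matrixConfig (fundamentalRep (Fin 2)) (U x s.toNNReal ω)) e i j) + ∑ n, Jc e n i j t ω :=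
      hω t e i j
    have hFc : Continuous fun s : ℝ => (latticeLangevinDynamics (fundamentalLatticeRep 2) β).drift
        (matrixConfig (fundamentalRep (Fin 2)) (U x s.toNNReal ω)) e i j := by
      have h1 : Continuous fun s : ℝ => U x s.toNNReal ω := hωc.comp continuous_real_toNNReal
      have h2 := (continuous_drift_matrixConfig β e).comp h1
      exact (continuous_apply j).comp ((continuous_apply i).comp h2)
    have hii : IntervalIntegrable (fun s : ℝ => (latticeLangevinDynamics (fundamentalLatticeRep 2) β).drift
        (matrixConfig (fundamentalRep (Fin 2)) (U x s.toNNReal ω)) e i j) volume (0 : ℝ) t :=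
      hFc.intervalIntegrable _ _
    -- the flat sum collapses to the link `e`
    have hsum : (∑ k : Fin d, Jp (eqv.symm k) t ω) =
        ∑ n : NoiseIdx 2, (fun z : ℂ => if c then z.im else z.re) (Jc e n i j t ω) := by
      rw [eqv.symm.sum_comp (fun p : Edge 3 L × NoiseIdx 2 => Jp p t ω), Fintype.sum_prod_type, Finset.sum_eq_single e]
      · simp only [hJp, if_true]
      · intro e' _ hne
        simp only [hJp, hne, if_false]
        exact Finset.sum_eq_zero fun n _ => hω0 (e', n) t
      · intro h; exact absurd (Finset.mem_univ e) h
    rw [hsum]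
    cases c
    · have hint := Complex.reCLM.intervalIntegral_comp_comm hii
      simp only [Complex.reCLM_apply] at hint
      have hre := congrArg Complex.re hC
      rw [Complex.add_re, Complex.add_re, ← hint, Complex.re_sum] at hre
      simp only [Bool.false_eq_true, if_false]
      exact hre
    · have hint := Complex.imCLM.intervalIntegral_comp_comm hii
      simp only [Complex.imCLM_apply] at hint
      have him := congrArg Complex.im hC
      rw [Complex.add_im, Complex.add_im, ← hint, Complex.im_sum] at him
      simp only [if_true]
      exact him
  -- the increment moments
  obtain ⟨hL4, h2, -⟩ := incr_moments (W := fun t ω k => W t ω (eqv.symm k))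
    (x := fun r ω => (fun z : ℂ => if c then z.im else z.re)
      ((fundamentalRep (Fin 2) (U x r ω e) : Matrix (Fin 2) (Fin 2) ℂ) i j))
    (σ := fun k => σp (eqv.symm k)) (J := fun k => Jp (eqv.symm k)) hW hβ hσ hβM hσM hJ hx huv
  refine ⟨hL4, h2.trans ?_⟩
  have hδ : 0 ≤ (v : ℝ) - u := sub_nonneg.mpr (NNReal.coe_le_coe.mpr huv)
  calc 2 * M ^ 2 * ((v : ℝ) - u) ^ 2 + 2 * (d : ℝ) ^ 2 * M ^ 2 * ((v : ℝ) - u)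
      ≤ max (2 * M ^ 2) (2 * (d : ℝ) ^ 2 * M ^ 2) * ((v : ℝ) - u) ^ 2 +
          max (2 * M ^ 2) (2 * (d : ℝ) ^ 2 * M ^ 2) * ((v : ℝ) - u) := by
        gcongr
        · exact le_max_left _ _
        · exact le_max_right _ _
    _ = max (2 * M ^ 2) (2 * (d : ℝ) ^ 2 * M ^ 2) * (((v : ℝ) - u) ^ 2 + ((v : ℝ) - u)) := by ring

end Summit.QuantumFields.YangMills.Theorems.ColdStartUniversality

end
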